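import Literature.Topology.FourManifolds.SurgeryTraceCobordism
import HarnessLib

/-!
# The trace of a surgery, III: the top end is the surgered manifold `χ(M, φ)`

Topic `Literature/Topology/FourManifolds` (fact seat of
`Literature.Topology.FourManifolds.isOrientedBordant_of_isEmpty_of_signature_eq_zero`, Kirby
1989, Cor. IX.2 with VIII Thm 1(A)).  Sequel of `SurgeryTraceCobordism.lean`.  J. Milnor,
*Lectures on the h-cobordism theorem* (1965), Thm. 3.12 (PDF pp. 17–19): the right-hand boundary
`-‖x‖² + ‖y‖² = +1` of the trace `ω(V, φ)` is *"identified with `χ(V, φ)`"*: it is covered by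
`(V - φ(S^{λ-1} × 0)) × {1}` and by the level `{‖y‖² - ‖x‖² = 1, ‖x‖ ‖y‖ < sinh 1 cosh 1}`
`≅ OD^λ × S^{n-λ-1}` (`(u sinh θ, v cosh θ) ↔ (θu, v)`), glued along `φ(u, θv) ∼ (θu, v)` — which is
Milnor's Def. 3.11 of the surgery `χ(V, φ)`.

Here, for a closed smooth `M` and one framed sphere `φ` (`ν : FramedSphereFamily (𝓡 (n + 1)) M ι k (l + 1)`,
`Unique ι`, `k + l = n`):

* `SurgeryTrace.topA ν hkl : ↥ν.complement → ↥(topEnd ν hkl)` — `x ↦ inl (x, 1)`, and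
  `SurgeryTrace.topB ν hkl : ↥(ballTimesSphere ι k l) → ↥(topEnd ν hkl)` —
  `(y, v) ↦ inr (top (y, v)) = inr (y, √(1 + ‖y‖²) v)`; both are **smooth embeddings with open
  ranges** (globally defined partial diffeomorphisms between boundaryless manifolds of the same
  dimension, `isSmoothEmbedding_of_openPartialHomeomorph`, Lee 2013 Prop. 5.2; the inverses are
  the retractions `SurgeryTrace.proj` and `SurgeryTrace.projF` of the trace), covering the top end,
  with `topA a = topB b ↔ sphereFamilySurgeryRel ν a b` (the gluing relation of the trace at
  `c = +1`: `fwd (v, θu) 1 = top (θv, u)`, `MilnorTrace.fwd_polarInv_one`);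
* `SurgeryTrace.isSurgery_topEnd : ν.IsSurgery (𝓡 (n + 1)) ↥(topEnd ν hkl)` — **the top end of the
  trace is obtained from `M` by surgery along `φ`** (`FramedSphereFamily.IsSurgery`,
  `SphereFamilySurgery.lean`);
* `SurgeryTrace.exists_isSurgery_isCobordant` — **surgery yields cobordant manifolds**: there is a
  closed smooth manifold `M'` (compact, Hausdorff, second countable, in `Type u`) obtained from `M`
  by surgery along `φ` and cobordant to `M` (Milnor 1965, Thm. 3.12).

Everything is proved; no named facts.

## References

* J. Milnor, *Lectures on the h-cobordism theorem* (1965), Def. 3.11, Thm. 3.12 and its proof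
  (PDF pp. 17–19). [MilnorHCobordism1965]
* M. Kervaire, J. Milnor, *Groups of homotopy spheres I*, Ann. of Math. 77 (1963), §1, §5.
  [KervaireMilnorAnnals1963]
* J. M. Lee, *Introduction to Smooth Manifolds*, 2nd ed. (2013), Prop. 5.2. [LeeSmoothManifolds2013]
-/

noncomputable section

open scoped Manifold ContDiff Topology
open Set Function Metric

namespace Literature.Topology.FourManifolds

universe u

/-- Local notation: `𝔼 n` is the model Euclidean space `EuclideanSpace ℝ (Fin n)`. -/
local notation "𝔼 " n:arg => EuclideanSpace ℝ (Fin n)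
/-- Local notation: `ℍ n` is the model half-space `EuclideanHalfSpace n`. -/
local notation "ℍ " n:arg => EuclideanHalfSpace n
/-- Local notation: `𝕊 n` is the unit sphere in `EuclideanSpace ℝ (Fin (n + 1))`. -/
local notation "𝕊 " n:arg => (Metric.sphere (0 : EuclideanSpace ℝ (Fin (n + 1))) 1)

attribute [local instance] fact_finrank_euclideanSpace_succ

namespace SurgeryTrace

open MilnorTrace

variable {n k l : ℕ} {M : Type u} [TopologicalSpace M] [ChartedSpace (𝔼 (n + 1)) M]
  [T2Space M] [IsManifold (𝓡 (n + 1)) ∞ M]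
  {ι : Type} [Unique ι] (ν : FramedSphereFamily (𝓡 (n + 1)) M ι k (l + 1)) (hkl : k + l = n)

/-! ### The retraction of the trace onto the model `ℝᵏ⁺¹ × ℝˡ⁺¹` -/

/-- **The retraction of the trace onto `ℝᵏ⁺¹ × ℝˡ⁺¹`**: `fwdLPt` on the cylinder piece, the
underlying point on `L` (compatible by the very definition of the gluing map); a left inverse of
`inr`, smooth at the points of `L`. [folklore] -/
def projF : Trace ν hkl → (𝔼 (k + 1)) × (𝔼 (l + 1)) :=
  (glueData ν hkl).desc (fun a : ↥(cylPiece ν) => fwdLPt ν a.1)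
    (fun b : ↥(Lpiece hkl) => (b : Slab k l n hkl).val) (fun _ _ => rfl)

/-- The retraction on `inr b` is the underlying point. [folklore] -/
@[simp] theorem projF_inr (b : ↥(Lpiece hkl)) : projF ν hkl ((glueData ν hkl).inr b) = (b : Slab k l n hkl).val :=
  rfl

/-- The retraction on `inl a` is `fwdLPt a`. [folklore] -/
@[simp] theorem projF_inl (a : ↥(cylPiece ν)) : projF ν hkl ((glueData ν hkl).inl a) = fwdLPt ν a.1 := rfl

/-- The retraction onto the model is smooth at the points of `L`. [folklore] -/
theorem contMDiffAt_projF_inr (b : ↥(Lpiece hkl)) :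
    ContMDiffAt (𝓡∂ (n + 1 + 1)) 𝓘(ℝ, (𝔼 (k + 1)) × (𝔼 (l + 1))) ∞ (projF ν hkl) ((glueData ν hkl).inr b) :=
  contMDiffAt_of_comp_isImmersionAt ((glueData ν hkl).isSmoothEmbedding_inrH.isImmersion.isImmersionAt b)
    (glueData ν hkl).isOpenMap_inr (((Slab.contMDiff_val hkl).comp contMDiff_subtype_val) b)
    (fun b' => projF_inr ν hkl b')

/-! ### The top piece `(M ∖ core) × {1}` -/

section TopA

/-- The top point `(x, 1)` of the cylinder over `x`. [folklore] -/
def topCyl (x : M) : ↥(Cylinder.carrier M) := Cylinder.sliceEnd M 1 ⟨zero_le_one, le_rfl⟩ x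

omit [TopologicalSpace M] [T2Space M] [IsManifold (𝓡 (n + 1)) ∞ M] in
/-- The underlying pair of `topCyl x` is `(x, 1)`. [folklore] -/
@[simp] theorem coe_topCyl (x : M) : (topCyl x : M × ℝ) = (x, 1) := rfl

/-- `inl (x, 1)` for `x` off the core, as a point of the trace. [folklore] -/
def topAPt (a : ↥ν.complement) : Trace ν hkl := (glueData ν hkl).inl ⟨topCyl a.1, a.2⟩

/-- `inl (x, 1)` is a boundary point of height `1`. [folklore] -/
theorem topAPt_mem (a : ↥ν.complement) :
    topAPt ν hkl a ∈ (𝓡∂ (n + 1 + 1)).boundary (Trace ν hkl) ∧ traceHeight ν hkl (topAPt ν hkl a) = 1 := by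
  refine ⟨(isBoundaryPoint_inl_iff ν hkl _).2 (Or.inr rfl), ?_⟩
  rw [topAPt, traceHeight_inl]
  show (2 : ℝ) * 1 - 1 = 1
  norm_num

/-- **The top inclusion of `M ∖ core`**: `x ↦ inl (x, 1)` with values in the top end.
[cite: MilnorHCobordism1965, Thm. 3.12, proof ("(V - φ(S^{λ-1} × 0)) × D¹")] -/
def topA (a : ↥ν.complement) : ↥(topEnd ν hkl) :=
  ⟨⟨topAPt ν hkl a, (topAPt_mem ν hkl a).1⟩, (mem_topEnd_iff ν hkl).2 (topAPt_mem ν hkl a).2⟩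

/-- The underlying point of `topA a`. [folklore] -/
@[simp] theorem coe_coe_topA (a : ↥ν.complement) :
    ((topA ν hkl a : ↥((𝓡∂ (n + 1 + 1)).boundary (Trace ν hkl))) : Trace ν hkl) = topAPt ν hkl a := rfl

/-- `topA` is smooth. [folklore] -/
theorem contMDiff_topA : ContMDiff (𝓡 (n + 1)) (𝓡 (n + 1)) ∞ (topA ν hkl) := by
  have h1 : ContMDiff (𝓡 (n + 1)) (𝓡∂ (n + 1 + 1)) ∞ (topAPt ν hkl) := by
    refine (glueData ν hkl).contMDiff_inlH.comp ?_
    intro a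
    rw [← ContMDiffAt.subtypeVal_comp_iff]
    exact ((Cylinder.isSmoothEmbedding_sliceEnd_one (n + 1) (M := M)).contMDiff.comp
      contMDiff_subtype_val) a
  intro a
  rw [← ContMDiffAt.subtypeVal_comp_iff]
  exact BoundaryManifold.contMDiffAt_codRestrict (fun a => (topAPt_mem ν hkl a).1) (h1 a)

/-- A base point of `M ∖ core` (junk value): `φ(e₀, w₀)` with `w₀ ≠ 0`. [folklore] -/
def basePtCompl : ↥ν.complement :=
  ⟨ν.toFun default (spherePt k, FramedSphereFamily.halfVec),
    ν.apply_mem_complement _ _ FramedSphereFamily.halfVec_ne_zero⟩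

/-- The inverse of `topA`: `proj` on the top end, corestricted to `M ∖ core` (junk off the
image). [folklore] -/
def topAInv (y : ↥(topEnd ν hkl)) : ↥ν.complement := by
  classical
  exact if h : proj ν hkl y.1.1 ∈ ν.complement then ⟨proj ν hkl y.1.1, h⟩ else basePtCompl ν

/-- `proj ∘ topAPt = val`. [folklore] -/
theorem proj_topAPt (a : ↥ν.complement) : proj ν hkl (topAPt ν hkl a) = a.1 := rfl

/-- `topAInv ∘ topA = id`. [folklore] -/
theorem topAInv_topA (a : ↥ν.complement) : topAInv ν hkl (topA ν hkl a) = a := by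
  classical
  have h : proj ν hkl (topA ν hkl a).1.1 ∈ ν.complement := a.2
  rw [topAInv, dif_pos h]
  exact Subtype.ext (proj_topAPt ν hkl a)

/-- A point of the top end in the image of the cylinder piece: its projection lies off the core
and `topA` of it is the point. [folklore] -/
theorem topA_proj {y : ↥(topEnd ν hkl)} {a : ↥(cylPiece ν)} (hy : (glueData ν hkl).inl a = y.1.1) :
    ∃ ha : proj ν hkl y.1.1 ∈ ν.complement, topA ν hkl ⟨proj ν hkl y.1.1, ha⟩ = y := by
  have hh := (mem_topEnd_iff ν hkl).1 y.2
  rw [← hy, traceHeight_inl] at hh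
  have ht : a.1.1.2 = 1 := by linarith
  have hp : proj ν hkl y.1.1 = a.1.1.1 := by rw [← hy, proj_inl]
  refine ⟨hp ▸ a.2, ?_⟩
  apply Subtype.ext; apply Subtype.ext
  show topAPt ν hkl ⟨proj ν hkl y.1.1, _⟩ = y.1.1
  refine Eq.trans ?_ hy
  simp only [topAPt]
  congr 1
  apply Subtype.ext; apply Subtype.ext
  simp only [coe_topCyl, hp]
  exact Prod.ext rfl ht.symm

/-- `topAInv` is smooth at the points of the image of the cylinder piece. [folklore] -/
theorem contMDiffAt_topAInv {y : ↥(topEnd ν hkl)} {a : ↥(cylPiece ν)} (hy : (glueData ν hkl).inl a = y.1.1) :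
    ContMDiffAt (𝓡 (n + 1)) (𝓡 (n + 1)) ∞ (topAInv ν hkl) y := by
  classical
  rw [← ContMDiffAt.subtypeVal_comp_iff]
  have ho : IsOpen {y : ↥(topEnd ν hkl) | y.1.1 ∈ range (glueData ν hkl).inl} :=
    (glueData ν hkl).isOpen_range_inl.preimage (continuous_subtype_val.comp continuous_subtype_val)
  have hev : (Subtype.val ∘ topAInv ν hkl) =ᶠ[𝓝 y] fun y => proj ν hkl y.1.1 := by
    filter_upwards [ho.mem_nhds ⟨a, hy⟩] with y' hy'
    obtain ⟨a', ha'⟩ := hy'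
    obtain ⟨hmem, -⟩ := topA_proj ν hkl ha'
    simp only [comp_apply, topAInv, dif_pos hmem]
  refine ContMDiffAt.congr_of_eventuallyEq ?_ hev
  refine (contMDiffAt_subtype_iff (U := topEnd ν hkl)
    (f := fun z : ↥((𝓡∂ (n + 1 + 1)).boundary (Trace ν hkl)) => proj ν hkl z.1)).2 ?_
  refine BoundaryManifold.contMDiffAt_comp_val ?_
  rw [← hy]
  exact contMDiffAt_proj_inl ν hkl a

/-- **`topA` as a globally defined partial diffeomorphism onto an open subset of the top end.**
[folklore] -/
def topAHomeo : OpenPartialHomeomorph (↥ν.complement) ↥(topEnd ν hkl) where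
  toFun := topA ν hkl
  invFun := topAInv ν hkl
  source := univ
  target := {y | y.1.1 ∈ range (glueData ν hkl).inl}
  map_source' a _ := ⟨⟨topCyl a.1, a.2⟩, rfl⟩
  map_target' _ _ := mem_univ _
  left_inv' a _ := topAInv_topA ν hkl a
  right_inv' := by
    classical
    rintro y ⟨a, ha⟩
    obtain ⟨hmem, hy⟩ := topA_proj ν hkl ha
    rw [topAInv, dif_pos hmem, hy]
  open_source := isOpen_univ
  open_target := (glueData ν hkl).isOpen_range_inl.preimage
    (continuous_subtype_val.comp continuous_subtype_val)
  continuousOn_toFun := (contMDiff_topA ν hkl).continuous.continuousOn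
  continuousOn_invFun := by
    rintro y ⟨a, ha⟩
    exact (contMDiffAt_topAInv ν hkl ha).continuousAt.continuousWithinAt

/-- **`topA` is a smooth embedding** (Lee 2013, Prop. 5.2). [cite: LeeSmoothManifolds2013, Prop. 5.2] -/
theorem isSmoothEmbedding_topA : Manifold.IsSmoothEmbedding (𝓡 (n + 1)) (𝓡 (n + 1)) ∞ (topA ν hkl) := by
  have h := isSmoothEmbedding_of_openPartialHomeomorph (I := 𝓡 (n + 1)) (J := 𝓡 (n + 1)) (n := ∞)
    (topAHomeo ν hkl) rfl (contMDiff_topA ν hkl).contMDiffOn (by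
      rintro y ⟨a, ha⟩
      exact (contMDiffAt_topAInv ν hkl ha).contMDiffWithinAt) (ContinuousLinearEquiv.refl ℝ _)
  exact h

/-- The range of `topA` is the (open) image of the cylinder piece in the top end. [folklore] -/
theorem range_topA : range (topA ν hkl) = {y : ↥(topEnd ν hkl) | y.1.1 ∈ range (glueData ν hkl).inl} := by
  ext y
  constructor
  · rintro ⟨a, rfl⟩
    exact ⟨⟨topCyl a.1, a.2⟩, rfl⟩
  · rintro ⟨a, ha⟩
    obtain ⟨hmem, hy⟩ := topA_proj ν hkl ha
    exact ⟨_, hy⟩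

/-- The range of `topA` is open. [folklore] -/
theorem isOpen_range_topA : IsOpen (range (topA ν hkl)) := by
  rw [range_topA]
  exact (glueData ν hkl).isOpen_range_inl.preimage (continuous_subtype_val.comp continuous_subtype_val)

end TopA

/-! ### The new piece `OD^{k+1} × Sˡ` -/

section TopB

omit [Unique ι] in
/-- `levelSq (top b) = 1 ≤ 1`. [folklore] -/
theorem levelSq_top_le (b : (𝔼 (k + 1)) × (𝕊 l)) : levelSq (top b) ≤ 1 := by
  rw [levelSq, level_top]; norm_num

/-- The top point of the slab over `(y, v)`: `top (y, v) = (y, √(1 + ‖y‖²) v)`.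
[cite: MilnorHCobordism1965, Thm. 3.12, proof ("(u sinh θ, v cosh θ) ↔ (θu, v)")] -/
def topSlab (b : ↥(ballTimesSphere ι k l)) : Slab k l n hkl :=
  Slab.mk hkl (top b.1.2) (levelSq_top_le _)

omit [Unique ι] in
/-- The underlying point of `topSlab`. [folklore] -/
@[simp] theorem val_topSlab (b : ↥(ballTimesSphere ι k l)) : (topSlab hkl b).val = top b.1.2 := rfl

omit [Unique ι] in
/-- The top point lies in `L`. [folklore] -/
theorem topSlab_mem (b : ↥(ballTimesSphere ι k l)) : topSlab hkl b ∈ Lpiece hkl := by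
  rw [mem_Lpiece, val_topSlab, orbit_top_lt_two_iff]
  exact b.2

/-- `inr (top (y, v))`, as a point of the trace. [folklore] -/
def topBPt (b : ↥(ballTimesSphere ι k l)) : Trace ν hkl := (glueData ν hkl).inr ⟨topSlab hkl b, topSlab_mem hkl b⟩

/-- `inr (top (y, v))` is a boundary point of height `1`. [folklore] -/
theorem topBPt_mem (b : ↥(ballTimesSphere ι k l)) :
    topBPt ν hkl b ∈ (𝓡∂ (n + 1 + 1)).boundary (Trace ν hkl) ∧ traceHeight ν hkl (topBPt ν hkl b) = 1 := by
  refine ⟨(isBoundaryPoint_inr_iff ν hkl _).2 (Or.inl ?_), ?_⟩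
  · show level (top b.1.2) = 1
    exact level_top _
  · rw [topBPt, traceHeight_inr]
    exact level_top _

/-- **The top inclusion of the new piece**: `(y, v) ↦ inr (y, √(1 + ‖y‖²) v)` with values in the
top end. [cite: MilnorHCobordism1965, Thm. 3.12, proof ("the right boundary … identified with χ(V, φ)")] -/
def topB (b : ↥(ballTimesSphere ι k l)) : ↥(topEnd ν hkl) :=
  ⟨⟨topBPt ν hkl b, (topBPt_mem ν hkl b).1⟩, (mem_topEnd_iff ν hkl).2 (topBPt_mem ν hkl b).2⟩

/-- The underlying point of `topB b`. [folklore] -/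
@[simp] theorem coe_coe_topB (b : ↥(ballTimesSphere ι k l)) :
    ((topB ν hkl b : ↥((𝓡∂ (n + 1 + 1)).boundary (Trace ν hkl))) : Trace ν hkl) = topBPt ν hkl b := rfl

/-- `topB` is smooth. [folklore] -/
theorem contMDiff_topB : ContMDiff (SphereSurgery.handleModelWithCorners k l) (𝓡 (n + 1)) ∞ (topB ν hkl) := by
  have h0 : ContMDiff (SphereSurgery.handleModelWithCorners k l) 𝓘(ℝ, (𝔼 (k + 1)) × (𝔼 (l + 1))) ∞
      fun b : ↥(ballTimesSphere ι k l) => top b.1.2 :=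
    contMDiff_top.comp (contMDiff_snd.comp contMDiff_subtype_val)
  have h1 : ContMDiff (SphereSurgery.handleModelWithCorners k l) (𝓡∂ (n + 1 + 1)) ∞ (topBPt ν hkl) := by
    refine (glueData ν hkl).contMDiff_inrH.comp ?_
    intro b
    rw [← ContMDiffAt.subtypeVal_comp_iff]
    exact Slab.contMDiffAt_mk hkl (fun b => levelSq_top_le _) (h0 b)
  intro b
  rw [← ContMDiffAt.subtypeVal_comp_iff]
  exact BoundaryManifold.contMDiffAt_codRestrict (fun b => (topBPt_mem ν hkl b).1) (h1 b)

/-- A base point of the new piece (junk value). [folklore] -/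
def basePtBall : ↥(ballTimesSphere ι k l) :=
  ⟨(DiscreteIndex.mk default, ((0 : 𝔼 (k + 1)), spherePt l)), by simp⟩

/-- The point of the new piece under the model point `p` (meaningful for `level p = 1`):
`(x, y/‖y‖)`. [folklore] -/
def ballPt (p : (𝔼 (k + 1)) × (𝔼 (l + 1))) : DiscreteIndex ι × ((𝔼 (k + 1)) × (𝕊 l)) :=
  (DiscreteIndex.mk default, (p.1, radialProjection (spherePt l) p.2))

/-- The inverse of `topB`: `ballPt ∘ projF` on the top end (junk off the image). [folklore] -/
def topBInv (y : ↥(topEnd ν hkl)) : ↥(ballTimesSphere ι k l) := by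
  classical
  exact if h : ballPt (ι := ι) (projF ν hkl y.1.1) ∈ ballTimesSphere ι k l then ⟨_, h⟩ else basePtBall

omit [T2Space M] [IsManifold (𝓡 (n + 1)) ∞ M] in
/-- `ballPt (top b) = b`. [folklore] -/
theorem ballPt_top (b : ↥(ballTimesSphere ι k l)) : ballPt (ι := ι) (top b.1.2) = b.1 := by
  obtain ⟨⟨i, y, v⟩, hb⟩ := b
  have hi : DiscreteIndex.mk (default : ι) = i :=
    DiscreteIndex.mk.symm.injective (Subsingleton.elim _ _)
  simp only [ballPt, radialProjection_top_snd, Prod.mk.injEq, hi, true_and, and_true]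
  rfl

/-- `topBInv ∘ topB = id`. [folklore] -/
theorem topBInv_topB (b : ↥(ballTimesSphere ι k l)) : topBInv ν hkl (topB ν hkl b) = b := by
  classical
  have hproj : projF ν hkl (topB ν hkl b).1.1 = top b.1.2 := rfl
  have hmem : ballPt (ι := ι) (projF ν hkl (topB ν hkl b).1.1) ∈ ballTimesSphere ι k l := by
    rw [hproj, ballPt_top]; exact b.2
  rw [topBInv, dif_pos hmem]
  apply Subtype.ext
  rw [Subtype.coe_mk, hproj, ballPt_top]

/-- A point of the top end in the image of `L`: its model point is `top` of its ball point,
which lies in the new piece, and `topB` of it is the point. [folklore] -/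
theorem topB_projF {y : ↥(topEnd ν hkl)} {b : ↥(Lpiece hkl)} (hy : (glueData ν hkl).inr b = y.1.1) :
    ∃ hb : ballPt (ι := ι) (projF ν hkl y.1.1) ∈ ballTimesSphere ι k l,
      top (ballPt (ι := ι) (projF ν hkl y.1.1)).2 = projF ν hkl y.1.1 ∧ topB ν hkl ⟨_, hb⟩ = y := by
  have hh := (mem_topEnd_iff ν hkl).1 y.2
  rw [← hy, traceHeight_inr] at hh
  have hp : projF ν hkl y.1.1 = (b : Slab k l n hkl).val := by rw [← hy, projF_inr]
  have htop : top (ballPt (ι := ι) (projF ν hkl y.1.1)).2 = projF ν hkl y.1.1 := by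
    rw [hp]; exact top_bwdTop hh
  have hmem : ballPt (ι := ι) (projF ν hkl y.1.1) ∈ ballTimesSphere ι k l := by
    rw [mem_ballTimesSphere_iff, ← orbit_top_lt_two_iff, htop, hp]
    exact b.2
  refine ⟨hmem, htop, ?_⟩
  apply Subtype.ext; apply Subtype.ext
  show topBPt ν hkl ⟨_, hmem⟩ = y.1.1
  refine Eq.trans ?_ hy
  simp only [topBPt]
  congr 1
  apply Subtype.ext; apply Slab.ext
  rw [val_topSlab, htop, hp]

/-- `topBInv` is smooth at the points of the image of `L`. [folklore] -/
theorem contMDiffAt_topBInv {y : ↥(topEnd ν hkl)} {b : ↥(Lpiece hkl)} (hy : (glueData ν hkl).inr b = y.1.1) :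
    ContMDiffAt (𝓡 (n + 1)) (SphereSurgery.handleModelWithCorners k l) ∞ (topBInv ν hkl) y := by
  classical
  rw [← ContMDiffAt.subtypeVal_comp_iff]
  have ho : IsOpen {y : ↥(topEnd ν hkl) | y.1.1 ∈ range (glueData ν hkl).inr} :=
    (glueData ν hkl).isOpen_range_inr.preimage (continuous_subtype_val.comp continuous_subtype_val)
  have hev : (Subtype.val ∘ topBInv ν hkl) =ᶠ[𝓝 y] fun y => ballPt (ι := ι) (projF ν hkl y.1.1) := by
    filter_upwards [ho.mem_nhds ⟨b, hy⟩] with y' hy'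
    obtain ⟨b', hb'⟩ := hy'
    obtain ⟨hmem, -, -⟩ := topB_projF ν hkl hb'
    simp only [comp_apply, topBInv, dif_pos hmem]
  refine ContMDiffAt.congr_of_eventuallyEq ?_ hev
  -- `y ↦ projF y` is smooth at `y`, with value `b.val` off `y = 0`
  have h1 : ContMDiffAt (𝓡 (n + 1)) 𝓘(ℝ, (𝔼 (k + 1)) × (𝔼 (l + 1))) ∞
      (fun z : ↥(topEnd ν hkl) => projF ν hkl z.1.1) y := by
    refine (contMDiffAt_subtype_iff (U := topEnd ν hkl)
      (f := fun z : ↥((𝓡∂ (n + 1 + 1)).boundary (Trace ν hkl)) => projF ν hkl z.1)).2 ?_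
    refine BoundaryManifold.contMDiffAt_comp_val ?_
    rw [← hy]
    exact contMDiffAt_projF_inr ν hkl b
  have hy0 : (projF ν hkl y.1.1).2 ≠ 0 := by
    obtain ⟨-, htop, -⟩ := topB_projF ν hkl hy
    rw [← htop]; exact top_snd_ne_zero _
  have h2 : ContMDiffAt 𝓘(ℝ, (𝔼 (k + 1)) × (𝔼 (l + 1))) (SphereSurgery.handleModelWithCorners k l) ∞
      (ballPt (ι := ι)) (projF ν hkl y.1.1) := by
    refine contMDiffAt_const.prodMk (ContMDiffAt.prodMk ?_ ?_)
    · exact (contDiff_fst (E := 𝔼 (k + 1)) (F := 𝔼 (l + 1))).contMDiff.contMDiffAt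
    · exact ((contMDiffOn_radialProjection _).contMDiffAt ((isOpen_ne.mem_nhds hy0))).comp _
        (contDiff_snd (E := 𝔼 (k + 1)) (F := 𝔼 (l + 1))).contMDiff.contMDiffAt
  have h3 := h2.comp y h1
  exact h3

/-- **`topB` as a globally defined partial diffeomorphism onto an open subset of the top end.**
[folklore] -/
def topBHomeo : OpenPartialHomeomorph ↥(ballTimesSphere ι k l) ↥(topEnd ν hkl) where
  toFun := topB ν hkl
  invFun := topBInv ν hkl
  source := univ
  target := {y | y.1.1 ∈ range (glueData ν hkl).inr}
  map_source' b _ := ⟨⟨topSlab hkl b, topSlab_mem hkl b⟩, rfl⟩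
  map_target' _ _ := mem_univ _
  left_inv' b _ := topBInv_topB ν hkl b
  right_inv' := by
    classical
    rintro y ⟨b, hb⟩
    obtain ⟨hmem, -, hy⟩ := topB_projF ν hkl hb
    rw [topBInv, dif_pos hmem, hy]
  open_source := isOpen_univ
  open_target := (glueData ν hkl).isOpen_range_inr.preimage
    (continuous_subtype_val.comp continuous_subtype_val)
  continuousOn_toFun := (contMDiff_topB ν hkl).continuous.continuousOn
  continuousOn_invFun := by
    rintro y ⟨b, hb⟩
    exact (contMDiffAt_topBInv ν hkl hb).continuousAt.continuousWithinAt

/-- **`topB` is a smooth embedding** (Lee 2013, Prop. 5.2; the model vector spaces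
`ℝ⁰ × (ℝᵏ⁺¹ × ℝˡ)` and `ℝⁿ⁺¹` are identified by `SphereSurgery.handleLin`).
[cite: LeeSmoothManifolds2013, Prop. 5.2] -/
theorem isSmoothEmbedding_topB :
    Manifold.IsSmoothEmbedding (SphereSurgery.handleModelWithCorners k l) (𝓡 (n + 1)) ∞ (topB ν hkl) := by
  have h := isSmoothEmbedding_of_openPartialHomeomorph (I := SphereSurgery.handleModelWithCorners k l)
    (J := 𝓡 (n + 1)) (n := ∞) (topBHomeo ν hkl) rfl (contMDiff_topB ν hkl).contMDiffOn (by
      rintro y ⟨b, hb⟩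
      exact (contMDiffAt_topBInv ν hkl hb).contMDiffWithinAt) (SphereSurgery.handleLin hkl)
  exact h

/-- The range of `topB` is the (open) image of `L` in the top end. [folklore] -/
theorem range_topB : range (topB ν hkl) = {y : ↥(topEnd ν hkl) | y.1.1 ∈ range (glueData ν hkl).inr} := by
  ext y
  constructor
  · rintro ⟨b, rfl⟩
    exact ⟨⟨topSlab hkl b, topSlab_mem hkl b⟩, rfl⟩
  · rintro ⟨b, hb⟩
    obtain ⟨hmem, -, hy⟩ := topB_projF ν hkl hb
    exact ⟨_, hy⟩

/-- The range of `topB` is open. [folklore] -/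
theorem isOpen_range_topB : IsOpen (range (topB ν hkl)) := by
  rw [range_topB]
  exact (glueData ν hkl).isOpen_range_inr.preimage (continuous_subtype_val.comp continuous_subtype_val)

end TopB

/-! ### The top end is the surgery -/

section Surgery

/-- The two top pieces cover the top end. [folklore] -/
theorem range_topA_union_range_topB : range (topA ν hkl) ∪ range (topB ν hkl) = univ := by
  rw [range_topA, range_topB, ← univ_subset_iff]
  intro y _
  rcases (glueData ν hkl).exists_inl_or_inr y.1.1 with ⟨a, ha⟩ | ⟨b, hb⟩
  · exact Or.inl ⟨a, ha⟩
  · exact Or.inr ⟨b, hb⟩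

/-- **The gluing relation of the top end is Milnor's surgery identification**
`φ(v, θu) ∼ (θv, u)`: `topA a = topB b ↔ sphereFamilySurgeryRel ν a b` (the relation of the
trace at `c = +1`, `fwd (v, θu) 1 = top (θv, u)`). [cite: MilnorHCobordism1965, Def. 3.11 and Thm. 3.12, proof] -/
theorem topA_eq_topB_iff (a : ↥ν.complement) (b : ↥(ballTimesSphere ι k l)) :
    topA ν hkl a = topB ν hkl b ↔ sphereFamilySurgeryRel ν a b := by
  have hidx : DiscreteIndex.mk.symm (b : DiscreteIndex ι × ((𝔼 (k + 1)) × (𝕊 l))).1 = default :=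
    Subsingleton.elim _ _
  -- reduce to the gluing relation in the trace
  have key : topA ν hkl a = topB ν hkl b ↔
      (a : M) ∈ pTube ν ∧ top b.1.2 = fwd ((tubeHomeo ν).symm a) 1 := by
    rw [Subtype.ext_iff, Subtype.ext_iff, coe_coe_topA, coe_coe_topB, topAPt, topBPt, inl_eq_inr_iff]
    show (a : M) ∈ pTube ν ∧ top b.1.2 = fwdPt ν (topCyl (a : M)) ↔ _
    rw [topCyl, show Cylinder.sliceEnd M 1 ⟨zero_le_one, le_rfl⟩ (a : M) =
      ⟨((a : M), 1), Cylinder.mem_carrier_iff.2 ⟨zero_le_one, le_rfl⟩⟩ from rfl]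
    simp only [fwdPt]
    norm_num
  rw [key]
  obtain ⟨⟨j, y, w⟩, hb⟩ := b
  constructor
  · rintro ⟨ha, htop⟩
    obtain ⟨⟨v, z⟩, hz0, hz1, hq⟩ := (mem_pTube_iff ν).1 ha
    rw [← hq, tubeHomeo_symm_apply] at htop
    have hθ : 0 < ‖z‖ := norm_pos_iff.2 hz0
    -- `fwd (v, z) 1 = top (‖z‖ • v, z/‖z‖)`
    have hpol : SphereSurgery.polarInv ((‖z‖ • (v : 𝔼 (k + 1))), radialProjection (spherePt l) z) = (v, z) := by
      simp only [SphereSurgery.polarInv, radialProjection_smul _ hθ, norm_smul_coe_sphere hθ.le,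
        norm_smul_coe_radialProjection]
    have hfwd : fwd (v, z) 1 = top ((‖z‖ • (v : 𝔼 (k + 1))), radialProjection (spherePt l) z) := by
      rw [← fwd_polarInv_one _ (by
        show ‖z‖ • (v : 𝔼 (k + 1)) ≠ 0
        exact smul_ne_zero hθ.ne' (ne_zero_of_mem_unit_sphere v)), hpol]
    rw [hfwd] at htop
    have hinj := top_injective htop
    simp only [Prod.mk.injEq] at hinj
    obtain ⟨hy, hw⟩ := hinj
    refine ⟨v, ‖z‖, ⟨hθ, hz1⟩, hy, ?_⟩
    show (a : M) = ν.toFun (DiscreteIndex.mk.symm j) (v, ‖z‖ • (w : 𝔼 (l + 1)))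
    rw [show DiscreteIndex.mk.symm j = default from Subsingleton.elim _ _, ← hq, hw,
      norm_smul_coe_radialProjection]
  · rintro ⟨v, θ, hθ, hy, hav⟩
    simp only at hy hav
    rw [hidx] at hav
    have hw0 : θ • (w : 𝔼 (l + 1)) ≠ 0 := smul_ne_zero hθ.1.ne' (ne_zero_of_mem_unit_sphere w)
    have hnorm : ‖θ • (w : 𝔼 (l + 1))‖ = θ := norm_smul_coe_sphere hθ.1.le w
    have ha : (a : M) ∈ pTube ν := by
      rw [hav, apply_mem_pTube_iff, hnorm]
      exact ⟨hw0, hθ.2⟩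
    refine ⟨ha, ?_⟩
    rw [hav, tubeHomeo_symm_apply]
    have hpol : SphereSurgery.polarInv ((θ • (v : 𝔼 (k + 1))), w) = (v, θ • (w : 𝔼 (l + 1))) := by
      simp only [SphereSurgery.polarInv, radialProjection_smul _ hθ.1, norm_smul_coe_sphere hθ.1.le]
    rw [← hpol, fwd_polarInv_one _ (by
      show θ • (v : 𝔼 (k + 1)) ≠ 0
      exact smul_ne_zero hθ.1.ne' (ne_zero_of_mem_unit_sphere v))]
    show top (y, w) = top (θ • (v : 𝔼 (k + 1)), w)
    rw [hy]

/-- **The top end of the trace is obtained from `M` by surgery along `φ`, with the explicit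
gluing maps `topA`, `topB`.** [cite: MilnorHCobordism1965, Def. 3.11 and Thm. 3.12 (PDF pp. 17–19)] -/
theorem isOpenGluingWith_topEnd :
    IsOpenGluingWith (𝓡 (n + 1)) (SphereSurgery.handleModelWithCorners k l) (𝓡 (n + 1))
      (A := ↥ν.complement) (B := ↥(ballTimesSphere ι k l)) (P := ↥(topEnd ν hkl))
      (sphereFamilySurgeryRel ν) (topA ν hkl) (topB ν hkl) :=
  ⟨isSmoothEmbedding_topA ν hkl, isOpen_range_topA ν hkl, isSmoothEmbedding_topB ν hkl,
    isOpen_range_topB ν hkl, range_topA_union_range_topB ν hkl, topA_eq_topB_iff ν hkl⟩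

/-- **Milnor 1965, Thm. 3.12: the top end of the trace `ω(M, φ)` is the surgered manifold
`χ(M, φ)`** — it is obtained from `M` by surgery along the framed sphere `φ`
(`FramedSphereFamily.IsSurgery`: an open gluing of `M ∖ φ(Sᵏ × 0)` and `OD^{k+1} × Sˡ` along
`φ(v, θu) ∼ (θv, u)`). [cite: MilnorHCobordism1965, Thm. 3.12 (PDF pp. 17–19)] -/
theorem isSurgery_topEnd : ν.IsSurgery (𝓡 (n + 1)) ↥(topEnd ν hkl) :=
  (isOpenGluingWith_topEnd ν hkl).isOpenGluing

include hkl in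
/-- **Surgery yields a cobordant manifold** (Milnor 1965, Thm. 3.12: "there exists an elementary
cobordism `(W; V, V')`"): for a closed smooth manifold `M` of dimension `n + 1` and a framed
sphere `φ : Sᵏ × ℝˡ⁺¹ ↪ M`, `k + l = n`, there is a closed smooth manifold `M'` (compact,
Hausdorff, second countable) obtained from `M` by surgery along `φ` and cobordant to `M` — namely
the top end of the trace. [cite: MilnorHCobordism1965, Thm. 3.12 (PDF pp. 17–19)] -/
theorem exists_isSurgery_isCobordant [CompactSpace M] :
    ∃ (M' : Type u) (_ : TopologicalSpace M') (_ : ChartedSpace (𝔼 (n + 1)) M')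
      (_ : IsManifold (𝓡 (n + 1)) ∞ M'), CompactSpace M' ∧ T2Space M' ∧ SecondCountableTopology M' ∧
      ν.IsSurgery (𝓡 (n + 1)) M' ∧ IsCobordant (n + 1) M M' :=
  ⟨↥(topEnd ν hkl), inferInstance, inferInstance, inferInstance, inferInstance, inferInstance,
    inferInstance, isSurgery_topEnd ν hkl, isCobordant_trace ν hkl⟩

end Surgery

end SurgeryTrace

end Literature.Topology.FourManifolds

end
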